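import Literature.NumberTheory.LFunctions.HalaszRestrictedDirichlet
import Literature.NumberTheory.LFunctions.TwistedPrimeSumTail
import Literature.NumberTheory.LFunctions.MeanSquareNearPeak
import Literature.NumberTheory.Sieve.HalaszMontgomeryTenenbaumProofs
import HarnessLib

/-!
# Halász's theorem for block-restricted sums, V: the window around the minimising twist

Topic `Literature/NumberTheory/LFunctions`.  Everything in this file is PROVED (conditionally on the named fact
`Khale2024_zeroFreeRegion` where stated); no definitions, no named facts.

In the proof of Proposition A.3 of K. Matomäki, M. Radziwiłł, T. Tao, *An averaged form of Chowla's
conjecture*, Algebra & Number Theory 9 (2015), Appendix A (arXiv:1503.05121, §6), the `t`-integral of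
`|F(1+it)|²`, `F(s) = ∑_{X ≤ n ≤ 2X, n ∈ 𝒮} f(n) n^{-s}`, is split into `𝒯₂ = {|t - t₁| ≥ (log X)^{1/16}}` and the
window `𝒯₀ ∪ 𝒯₁ = {|t - t₁| ≤ (log X)^{1/16}}` around the twist `t₁` minimising `u ↦ 𝔻(f, n^{iu}; X)²` on `|u| ≤ X`;
on the window the printed proof uses "the estimate `F(1+it) ≪ 1/|t-t₁|` for `t ∈ 𝒯₁` and the estimate
`F(1+it) ≪ exp(-M(f;X)) M(f;X)` coming from Halasz's theorem for `t ∈ 𝒯₀`".  For the `𝒮`-RESTRICTED polynomial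
Halász's theorem is available only with the HALVED distance (`Halasz.Restricted.norm_restr_sum_le`,
`M_½ ≥ M/2`), and this file carries out the window estimate in that form, for completely multiplicative `g`
(`|g| ≤ 1`) and an arbitrary block system of small primes:

* `MeanSquareNearPeak.integral_sq_le_peak_decay_on` — the real-variable lemma of `MeanSquareNearPeak.lean` with the
  two pointwise bounds assumed on a subinterval `[a, b] ⊆ [t₁ - L, t₁ + L]` only (and no side condition
  `D/B ≤ L`): `∫_a^b φ² ≤ 4RB² + 6DB + 4D²/L + 4LE²`;
* `Halasz.Restricted.near_min_of_height_mem` — a `δ`-near-minimiser of `M(X, T)` is a `(δ+4)`-near-minimiser of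
  `M(y, T)` at every height `X - 1 ≤ y ≤ 2X`;
* `Halasz.Restricted.minHalfDistSq_twist_ge_half_min` — the uniform input `M_½(g·n^{-it}; y, X/2) ≥ M(y, X)/2`
  for `|t| ≤ X/2`;
* `Halasz.Restricted.minHalfDistSq_twist_ge_decay` — the decaying input: for `8 ≤ |t - t₁| ≤ X/4`, `|t| ≤ X/2`,
  `M_½(g·n^{-it}; y, |t-t₁|/2) ≥ (log log(X-1) - θ log log 2X - 6)/4 - (δ+4)/2` (Khale's Vinogradov–Korobov region
  through `TwistedPrimeSumTail.halfDistSq_ge_of_far_from_minimiser`, any `2/3 < θ < 1`);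
* `Halasz.Restricted.integral_sq_restr_dirichlet_window_le` — **the window bound**: for `16 ≤ L ≤ X/4` and
  `[a, b] ⊆ [t₁ - L, t₁ + L] ∩ [-X/2, X/2]`,
  `∫_a^b |∑_{⌈X⌉ ≤ n ≤ ⌊2X⌋, n ∈ 𝒮} g(n) n^{-(1+it)}|² dt
     ≤ K ((1 + M) e^{-M/2} + 1/L + (|𝓙|+1)ρ + L ((|𝓙|+1)²ρ² + u²))`,
  `M = M(X, X)`, `ρ = √((log Q + 2)/log X)`, `u = (1 + M₁⁺)e^{-M₁⁺} = (log X)^{-(1-θ)/4 + o(1)}`, from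
  `Halasz.Restricted.norm_restr_dirichlet_le` at `T = X/2` (uniform) and `T = |t - t₁|/2` (decay).
  With `L = (log X)^{1/16}`, `Q = Q_J ≤ exp(√log X₀)`, `J ≪ log log X` this is
  `≪ (1 + M) e^{-M/2} + (log X)^{-1/16}`: the window's contribution to the restricted-Halász form
  `MRT2015.PropA3With (fun M => C (1 + M) e^{-M/2})` of Proposition A.3 (`MatomakiRadziwillTaoPropA3With.lean`),
  which implies Tao's log-averaged Elliott/Chowla theorems (`TaoLogElliottProp24OfPropA3With.lean`).

## References
* K. Matomäki, M. Radziwiłł, T. Tao, Algebra & Number Theory 9 (2015) 2167–2196, Appendix A, proof of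
  Proposition A.3 (the ranges `𝒯₀, 𝒯₁`; arXiv:1503.05121 p. 13). [cite: MatomakiRadziwillTao2015, Appendix A, Proposition A.3 (proof)]
* T. Khale, *An explicit Vinogradov–Korobov zero-free region for Dirichlet L-functions*, Q. J. Math. 75 (2024),
  Theorem 1.1. [cite: Khale2024, Theorem 1.1]

## Design choices
* General block systems (`IsBlockSystem 𝓙 blk (⌈X⌉₊ - 1)`, block primes `≤ Q ≤ exp(√log X)`, `Q ≥ e²`) as in
  `HalaszRestrictedDirichlet.lean`; the specialisation to the interval systems of Appendix A is left to the user.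
* The window is any `[a, b] ⊆ [t₁ - L, t₁ + L] ∩ [-X/2, X/2]` (Proposition A.3 needs `[0, T] ∩ [t₁ - L, t₁ + L]`
  with `T ≤ X/2`); thresholds are `∀ᶠ X in atTop`, constants absolute and not optimised (`K = 800 K₀²`).
-/

noncomputable section

open Finset Real Complex Filter MeasureTheory Set intervalIntegral
open scoped ComplexConjugate Classical

namespace Literature.NumberTheory.LFunctions

namespace MeanSquareNearPeak

/-- **Window mean square, local form.**  Let `φ ≥ 0` be continuous on `ℝ`, and suppose the two bounds of
`integral_sq_le_of_peak_decay` hold on a subinterval `[a, b] ⊆ [t₁ - L, t₁ + L]` only: `φ ≤ B` on `[a, b]` and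
`φ(t) ≤ D/|t - t₁| + E` for `t ∈ [a, b]`, `|t - t₁| ≥ R` (`B > 0`, `D, E ≥ 0`, `0 < R`, `2R ≤ L`).  Then
`∫_a^b φ² ≤ 4 R B² + 6 D B + 4 D²/L + 4 L E²` (no hypothesis `D/B ≤ L`: for `B < D/L` the split point is `S = L`).
Proof: apply the global lemmas (with `2R` for `R`) to `ψ = min(φ, β)`,
`β(t) = min(B, D/max(|t - t₁|, R) + E + B (2 - |t - t₁|/R)₊)`, which is continuous, satisfies both bounds on
all of `ℝ`, and majorises `φ` on `[a, b]`. [cite: MatomakiRadziwillTao2015, Appendix A, Proposition A.3 (proof)] -/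
theorem integral_sq_le_peak_decay_on {φ : ℝ → ℝ} (hφc : Continuous φ) (hφ0 : ∀ t, 0 ≤ φ t)
    {t₁ B D E R L a b : ℝ} (hB : 0 < B) (hD : 0 ≤ D) (hE : 0 ≤ E) (hR : 0 < R) (hRL : 2 * R ≤ L)
    (hab : a ≤ b) (ha : t₁ - L ≤ a) (hb : b ≤ t₁ + L)
    (hpeak : ∀ t ∈ Icc a b, φ t ≤ B)
    (hdecay : ∀ t ∈ Icc a b, R ≤ |t - t₁| → φ t ≤ D / |t - t₁| + E) :
    ∫ t in a..b, φ t ^ 2 ≤ 4 * R * B ^ 2 + 6 * D * B + 4 * D ^ 2 / L + 4 * L * E ^ 2 := by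
  -- the continuous majorant `β` and `ψ = min φ β`
  set β : ℝ → ℝ := fun t => min B (D / max |t - t₁| R + E + B * max 0 (2 - |t - t₁| / R)) with hβ
  set ψ : ℝ → ℝ := fun t => min (φ t) (β t) with hψ
  have hmax0 : ∀ t, 0 < max |t - t₁| R := fun t => hR.trans_le (le_max_right _ _)
  have hβc : Continuous β := by
    have h1 : Continuous fun t : ℝ => |t - t₁| := (continuous_id.sub continuous_const).abs
    refine continuous_const.min ((Continuous.add ?_ continuous_const).add
      (continuous_const.mul (continuous_const.max (continuous_const.sub (h1.div_const _)))))
    exact continuous_const.div (h1.max continuous_const) fun t => (hmax0 t).ne'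
  have hψc : Continuous ψ := hφc.min hβc
  have hfrac0 : ∀ t, 0 ≤ D / max |t - t₁| R := fun t => div_nonneg hD (hmax0 t).le
  have hbump0 : ∀ t, 0 ≤ B * max 0 (2 - |t - t₁| / R) := fun t =>
    mul_nonneg hB.le (le_max_left _ _)
  have hβ0 : ∀ t, 0 ≤ β t := fun t =>
    le_min hB.le (by linarith [hfrac0 t, hbump0 t])
  have hψ0 : ∀ t, 0 ≤ ψ t := fun t => le_min (hφ0 t) (hβ0 t)
  have hψB : ∀ t, ψ t ≤ B := fun t => (min_le_right _ _).trans (min_le_left _ _)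
  have hψdecay : ∀ t, 2 * R ≤ |t - t₁| → ψ t ≤ D / |t - t₁| + E := by
    intro t ht
    refine (min_le_right _ _).trans ((min_le_right _ _).trans ?_)
    have hRle : R ≤ |t - t₁| := by linarith
    have hbump : max 0 (2 - |t - t₁| / R) = 0 := by
      refine max_eq_left ?_
      rw [sub_nonpos, le_div_iff₀ hR]; linarith
    rw [max_eq_left hRle, hbump, mul_zero, add_zero]
  -- `ψ = φ` on `[a, b]`
  have hψφ : EqOn (fun t => ψ t ^ 2) (fun t => φ t ^ 2) (uIcc a b) := by
    intro t ht
    rw [uIcc_of_le hab] at ht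
    simp only
    congr 1
    refine min_eq_left (le_min (hpeak t ht) ?_)
    rcases le_or_gt R |t - t₁| with h | h
    · rw [max_eq_left h]
      have := hdecay t ht h
      linarith [hbump0 t]
    · have h1 : 1 ≤ max 0 (2 - |t - t₁| / R) := by
        refine le_trans ?_ (le_max_right _ _)
        have : |t - t₁| / R ≤ 1 := by rw [div_le_one hR]; exact h.le
        linarith
      have h2 : B ≤ B * max 0 (2 - |t - t₁| / R) := by nlinarith
      linarith [hpeak t ht, hfrac0 t]
  rw [← intervalIntegral.integral_congr hψφ]
  -- enlarge the interval
  have hint : ∀ c d : ℝ, IntervalIntegrable (fun t => ψ t ^ 2) volume c d := fun c d =>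
    (hψc.pow 2).intervalIntegrable _ _
  have hmono : ∫ t in a..b, ψ t ^ 2 ≤ ∫ t in (t₁ - L)..(t₁ + L), ψ t ^ 2 :=
    intervalIntegral.integral_mono_interval ha hab hb
      (Filter.Eventually.of_forall fun t => sq_nonneg (ψ t)) (hint _ _)
  refine hmono.trans ?_
  have hR2 : 0 < 2 * R := by linarith
  have hRB : 0 ≤ 4 * R * B ^ 2 := by positivity
  have hDB : 0 ≤ D * B := by positivity
  have hD2L : 0 ≤ 4 * D ^ 2 / L := by
    have : 0 < L := by linarith
    positivity
  rcases le_or_gt (D / B) L with hDBL | hDBL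
  · have h := integral_sq_le_peak_decay_opt hψc hψ0 hB hD hR2 hRL hDBL hψB hψdecay (t₁ := t₁) (E := E)
    refine h.trans ?_
    nlinarith
  · -- `B < D / L`: split at `S = L`
    have hL0 : 0 < L := by linarith
    have h := integral_sq_le_of_peak_decay hψc hψ0 hD hR2 hRL le_rfl hψB hψdecay (t₁ := t₁) (E := E)
      (B := B)
    refine h.trans ?_
    have hBL : B * L ≤ D := by
      have := hDBL.le
      rw [le_div_iff₀ hB] at this
      linarith
    have h1 : 2 * L * B ^ 2 ≤ 2 * D * B := by nlinarith
    nlinarith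

end MeanSquareNearPeak

namespace Halasz

namespace Restricted

open Literature.NumberTheory.Sieve (pretentiousDistSq minPretentiousDistSq minPretentiousDistSq_nonneg
  pretentiousDistSq_mono)

variable {g : ℕ → ℂ}

/-! ### Reciprocal sums of primes over short ranges, and near-minimisers at nearby heights -/

/-- `∑_{⌊a⌋ < p ≤ ⌊b⌋} 1/p ≤ (b - a + 1)/a` for `1 ≤ a ≤ b` (at most `b - a + 1` terms, each `≤ 1/a`). [folklore] -/
theorem sum_inv_prime_Ioc_le {a b : ℝ} (ha : 1 ≤ a) (hab : a ≤ b) :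
    ∑ p ∈ (Finset.Ioc ⌊a⌋₊ ⌊b⌋₊).filter Nat.Prime, (1 : ℝ) / p ≤ (b - a + 1) / a := by
  have ha0 : 0 < a := by linarith
  have hterm : ∀ p ∈ (Finset.Ioc ⌊a⌋₊ ⌊b⌋₊).filter Nat.Prime, (1 : ℝ) / p ≤ 1 / a := by
    intro p hp
    rw [Finset.mem_filter, Finset.mem_Ioc] at hp
    have h1 : (⌊a⌋₊ : ℝ) + 1 ≤ p := by exact_mod_cast hp.1.1
    have h2 : a < ⌊a⌋₊ + 1 := Nat.lt_floor_add_one a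
    exact one_div_le_one_div_of_le ha0 (by linarith)
  refine (Finset.sum_le_card_nsmul _ _ _ hterm).trans ?_
  rw [nsmul_eq_mul]
  have hcard : (((Finset.Ioc ⌊a⌋₊ ⌊b⌋₊).filter Nat.Prime).card : ℝ) ≤ b - a + 1 := by
    have h1 : ((Finset.Ioc ⌊a⌋₊ ⌊b⌋₊).filter Nat.Prime).card ≤ ⌊b⌋₊ - ⌊a⌋₊ :=
      (Finset.card_filter_le _ _).trans (by rw [Nat.card_Ioc])
    have hfl : ⌊a⌋₊ ≤ ⌊b⌋₊ := Nat.floor_le_floor hab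
    have h2 : (((Finset.Ioc ⌊a⌋₊ ⌊b⌋₊).filter Nat.Prime).card : ℝ) ≤ (⌊b⌋₊ : ℝ) - ⌊a⌋₊ := by
      have := (Nat.cast_le (α := ℝ)).2 h1
      rwa [Nat.cast_sub hfl] at this
    have h3 : (⌊b⌋₊ : ℝ) ≤ b := Nat.floor_le (by linarith)
    have h4 : a < ⌊a⌋₊ + 1 := Nat.lt_floor_add_one a
    linarith
  calc (((Finset.Ioc ⌊a⌋₊ ⌊b⌋₊).filter Nat.Prime).card : ℝ) * (1 / a)
      ≤ (b - a + 1) * (1 / a) := mul_le_mul_of_nonneg_right hcard (by positivity)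
    _ = (b - a + 1) / a := by ring

/-- `M(y, T) ≤ M(y', T)` for `y ≤ y'` (`T ≥ 0`): the minimum of the distance is monotone in the height. [folklore] -/
theorem minPretentiousDistSq_mono_height (hgb : ∀ n, ‖g n‖ ≤ 1) {T : ℝ} (hT : 0 ≤ T) {y y' : ℝ} (hy : y ≤ y') :
    minPretentiousDistSq g y T ≤ minPretentiousDistSq g y' T := by
  have hne : Nonempty (Set.Icc (-T) T) := ⟨⟨0, by simp [hT]⟩⟩
  unfold minPretentiousDistSq
  refine le_ciInf fun u => ?_
  refine (ciInf_le ⟨0, ?_⟩ u).trans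
    (pretentiousDistSq_mono hgb (fun n => Sieve.MatomakiRadziwillL4A.norm_natCast_cpow_mul_I n _) hy)
  rintro _ ⟨s, rfl⟩
  exact Sieve.pretentiousDistSq_nonneg hgb
    (fun n => Sieve.MatomakiRadziwillL4A.norm_natCast_cpow_mul_I n _) _

/-- `M(x, T) ≤ M(y, T) + 2 ∑_{⌊y⌋ < p ≤ ⌊x⌋} 1/p` for `y ≤ x` (`T ≥ 0`). [folklore] -/
theorem minPretentiousDistSq_le_add_tail (hgb : ∀ n, ‖g n‖ ≤ 1) {T : ℝ} (hT : 0 ≤ T) {y x : ℝ} (hyx : y ≤ x) :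
    minPretentiousDistSq g x T ≤ minPretentiousDistSq g y T +
      2 * ∑ p ∈ (Finset.Ioc ⌊y⌋₊ ⌊x⌋₊).filter Nat.Prime, (1 : ℝ) / p := by
  have hne : Nonempty (Set.Icc (-T) T) := ⟨⟨0, by simp [hT]⟩⟩
  unfold minPretentiousDistSq
  rw [← sub_le_iff_le_add]
  refine le_ciInf fun u => ?_
  have h1 := Sieve.HalaszMT.pretentiousDistSq_le_add_tail hgb
    (fun n => Sieve.MatomakiRadziwillL4A.norm_natCast_cpow_mul_I n (u : ℝ)) hyx (g := g)
  have h2 : (⨅ s : Set.Icc (-T) T, pretentiousDistSq g (fun n : ℕ => (n : ℂ) ^ (((s : ℝ) : ℂ) * I)) x) ≤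
      pretentiousDistSq g (fun n : ℕ => (n : ℂ) ^ (((u : ℝ) : ℂ) * I)) x := by
    refine ciInf_le ⟨0, ?_⟩ u
    rintro _ ⟨s, rfl⟩
    exact Sieve.pretentiousDistSq_nonneg hgb
      (fun n => Sieve.MatomakiRadziwillL4A.norm_natCast_cpow_mul_I n _) _
  linarith

/-- **Near-minimisers at nearby heights.**  If `𝔻(g, n^{it₁}; X)² ≤ M(X, T) + δ` and `X ≥ 4`, then for every
height `X - 1 ≤ y ≤ 2X`, `𝔻(g, n^{it₁}; y)² ≤ M(y, T) + δ + 4` (the distances at heights in `[X - 1, 2X]` differ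
by at most `2 ∑_{X-1 < p ≤ 2X} 1/p ≤ 4`). [folklore] -/
theorem near_min_of_height_mem (hgb : ∀ n, ‖g n‖ ≤ 1) {X T t₁ δ y : ℝ} (hX : 4 ≤ X) (hT : 0 ≤ T)
    (hmin : pretentiousDistSq g (fun n : ℕ => (n : ℂ) ^ ((t₁ : ℂ) * I)) X ≤ minPretentiousDistSq g X T + δ)
    (hy1 : X - 1 ≤ y) (hy2 : y ≤ 2 * X) :
    pretentiousDistSq g (fun n : ℕ => (n : ℂ) ^ ((t₁ : ℂ) * I)) y ≤ minPretentiousDistSq g y T + (δ + 4) := by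
  have hw : ∀ n : ℕ, ‖(n : ℂ) ^ ((t₁ : ℂ) * I)‖ ≤ 1 := fun n =>
    Sieve.MatomakiRadziwillL4A.norm_natCast_cpow_mul_I n t₁
  have h1 : pretentiousDistSq g (fun n : ℕ => (n : ℂ) ^ ((t₁ : ℂ) * I)) y ≤
      pretentiousDistSq g (fun n : ℕ => (n : ℂ) ^ ((t₁ : ℂ) * I)) (2 * X) := pretentiousDistSq_mono hgb hw hy2
  have h2 := Sieve.HalaszMT.pretentiousDistSq_le_add_tail hgb hw (by linarith : X ≤ 2 * X) (g := g)
  have h3 := minPretentiousDistSq_le_add_tail hgb hT (by linarith : X - 1 ≤ X) (g := g)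
  have h4 := minPretentiousDistSq_mono_height hgb hT hy1 (g := g)
  have h5 : ∑ p ∈ (Finset.Ioc ⌊X⌋₊ ⌊2 * X⌋₊).filter Nat.Prime, (1 : ℝ) / p ≤ 5 / 4 := by
    refine (sum_inv_prime_Ioc_le (by linarith) (by linarith)).trans ?_
    rw [div_le_div_iff₀ (by linarith) (by norm_num)]; nlinarith
  have h6 : ∑ p ∈ (Finset.Ioc ⌊X - 1⌋₊ ⌊X⌋₊).filter Nat.Prime, (1 : ℝ) / p ≤ 2 / 3 := by
    refine (sum_inv_prime_Ioc_le (by linarith) (by linarith)).trans ?_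
    rw [div_le_div_iff₀ (by linarith) (by norm_num)]; nlinarith
  linarith

/-! ### The uniform bound: `M_½ ≥ M/2` in the window `|t| ≤ X/2` -/

/-- For `|t| ≤ X/2` and every height `y`: `M(y, X)/2 ≤ M_½(g · n^{-it}; y, X/2)` — the twists `n^{i(t+u)}`,
`|u| ≤ X/2`, stay in the window `|t + u| ≤ X` of `M(y, X) = min_{|s| ≤ X} 𝔻(g, n^{is}; y)²`, and `𝔻_½² ≥ 𝔻²/2`.
[folklore] -/
theorem minHalfDistSq_twist_ge_half_min (hgb : ∀ n, ‖g n‖ ≤ 1) (E : Finset ℕ) {X t : ℝ} (hX : 0 ≤ X)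
    (ht : |t| ≤ X / 2) (y : ℝ) :
    minPretentiousDistSq g y X / 2 ≤
      minHalfDistSq E (fun n : ℕ => g n * (n : ℂ) ^ (-((t : ℂ) * I))) y (X / 2) := by
  have hX2 : 0 ≤ X / 2 := by linarith
  have hne : Nonempty (Set.Icc (-(X / 2)) (X / 2)) := ⟨⟨0, by simp [hX2]⟩⟩
  unfold minHalfDistSq
  refine le_ciInf fun u => ?_
  rw [halfDistSq_mul_twist]
  have hu : |(u : ℝ)| ≤ X / 2 := abs_le.2 ⟨u.2.1, u.2.2⟩
  have htu : |t + (u : ℝ)| ≤ X := by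
    have := abs_add_le t (u : ℝ); linarith
  have h1 := minPretentiousDistSq_le_of_abs_le hgb y htu
  have h2 := halfDistSq_ge_half hgb E (t + (u : ℝ)) y
  linarith

/-! ### Two thresholds -/

/-- For `θ < 1`: eventually `exp((log 2X)^θ) ≤ X - 1`. [folklore] -/
theorem eventually_exp_rpow_log_le {θ : ℝ} (hθ0 : 0 ≤ θ) (hθ1 : θ < 1) :
    ∀ᶠ X : ℝ in atTop, Real.exp (Real.log (2 * X) ^ θ) ≤ X - 1 := by
  have h1θ : 0 < 1 - θ := by linarith
  filter_upwards [eventually_ge_atTop (4 : ℝ),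
    Real.tendsto_log_atTop.eventually_ge_atTop ((4 : ℝ) ^ (1 / (1 - θ)))] with X hX hℓ
  set ℓ : ℝ := Real.log X with hℓdef
  have hX0 : 0 < X := by linarith
  have hℓ2 : Real.log 2 ≤ ℓ := Real.log_le_log (by norm_num) (by linarith)
  have hlog2 : 0 < Real.log 2 := Real.log_pos (by norm_num)
  have hℓ0 : 0 < ℓ := by linarith
  have hlog2X : Real.log (2 * X) = ℓ + Real.log 2 := by
    rw [Real.log_mul (by norm_num) hX0.ne', add_comm]
  have h2ℓ : Real.log (2 * X) ≤ 2 * ℓ := by rw [hlog2X]; linarith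
  have hℓ2' : (4 : ℝ) ^ (1 / (1 - θ)) ≤ 2 * ℓ := by
    have : 0 ≤ (4 : ℝ) ^ (1 / (1 - θ)) := by positivity
    linarith
  -- `(2ℓ)^θ ≤ 2ℓ / 4 = ℓ/2` since `(2ℓ)^{1-θ} ≥ 4`
  have h4 : (4 : ℝ) ≤ (2 * ℓ) ^ (1 - θ) := by
    have h41 : (4 : ℝ) = ((4 : ℝ) ^ (1 / (1 - θ))) ^ (1 - θ) := by
      rw [← Real.rpow_mul (by norm_num), one_div_mul_cancel h1θ.ne', Real.rpow_one]
    have := Real.rpow_le_rpow (by positivity) hℓ2' h1θ.le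
    rwa [← h41] at this
  have hpow : Real.log (2 * X) ^ θ ≤ ℓ / 2 := by
    have h0 : 0 ≤ Real.log (2 * X) := by rw [hlog2X]; positivity
    have hmul : (2 * ℓ) ^ θ * (2 * ℓ) ^ (1 - θ) = 2 * ℓ := by
      rw [← Real.rpow_add (by positivity)]; norm_num
    have hθpos : 0 ≤ (2 * ℓ) ^ θ := by positivity
    calc Real.log (2 * X) ^ θ ≤ (2 * ℓ) ^ θ := Real.rpow_le_rpow h0 h2ℓ hθ0
      _ ≤ (2 * ℓ) ^ θ * (2 * ℓ) ^ (1 - θ) / 4 := by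
          rw [le_div_iff₀ (by norm_num : (0:ℝ) < 4)]
          calc (2 * ℓ) ^ θ * 4 ≤ (2 * ℓ) ^ θ * (2 * ℓ) ^ (1 - θ) := mul_le_mul_of_nonneg_left h4 hθpos
            _ = (2 * ℓ) ^ θ * (2 * ℓ) ^ (1 - θ) := rfl
      _ = ℓ / 2 := by rw [hmul]; ring
  -- `ℓ/2 ≤ log (X - 1)` since `(X-1)² ≥ X`
  have hX1 : Real.exp (ℓ / 2) ≤ X - 1 := by
    have hsq : Real.exp (ℓ / 2) ^ 2 = X := by
      rw [← Real.exp_nat_mul]; push_cast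
      rw [show (2 : ℝ) * (ℓ / 2) = ℓ by ring, hℓdef, Real.exp_log hX0]
    nlinarith [Real.exp_pos (ℓ / 2)]
  exact (Real.exp_le_exp.2 hpow).trans hX1

/-- For `θ > 1/2`: eventually `exp(√(log X)) ≤ exp((log 2X)^θ) - 1`. [folklore] -/
theorem eventually_exp_sqrt_log_le {θ : ℝ} (hθ : 1 / 2 < θ) :
    ∀ᶠ X : ℝ in atTop, Real.exp (Real.sqrt (Real.log X)) ≤ Real.exp (Real.log (2 * X) ^ θ) - 1 := by
  have hθ0 : 0 < θ - 1 / 2 := by linarith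
  filter_upwards [eventually_ge_atTop (4 : ℝ),
    Real.tendsto_log_atTop.eventually_ge_atTop ((2 : ℝ) ^ (1 / (θ - 1 / 2))),
    Real.tendsto_log_atTop.eventually_ge_atTop (1 : ℝ)] with X hX hℓ hℓ1
  set ℓ : ℝ := Real.log X with hℓdef
  have hX0 : 0 < X := by linarith
  have hℓ0 : 0 < ℓ := by linarith
  have hlog2X : ℓ ≤ Real.log (2 * X) := Real.log_le_log hX0 (by linarith)
  -- `√ℓ + log 2 ≤ 2 √ℓ ≤ ℓ^θ`
  have hsqrt1 : 1 ≤ Real.sqrt ℓ := by rw [← Real.sqrt_one]; exact Real.sqrt_le_sqrt hℓ1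
  have hlog2 : Real.log 2 ≤ 1 := by
    have := Real.log_two_lt_d9; linarith
  have h2 : (2 : ℝ) ≤ ℓ ^ (θ - 1 / 2) := by
    have h21 : (2 : ℝ) = ((2 : ℝ) ^ (1 / (θ - 1 / 2))) ^ (θ - 1 / 2) := by
      rw [← Real.rpow_mul (by norm_num), one_div_mul_cancel hθ0.ne', Real.rpow_one]
    have := Real.rpow_le_rpow (by positivity) hℓ hθ0.le
    rwa [← h21] at this
  have hpow : 2 * Real.sqrt ℓ ≤ ℓ ^ θ := by
    have : ℓ ^ θ = ℓ ^ (1 / 2 : ℝ) * ℓ ^ (θ - 1 / 2) := by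
      rw [← Real.rpow_add hℓ0]; norm_num
    rw [this, ← Real.sqrt_eq_rpow, mul_comm]
    exact mul_le_mul_of_nonneg_left h2 (Real.sqrt_nonneg _)
  have hθpos : 0 ≤ θ := by linarith
  have hmono : ℓ ^ θ ≤ Real.log (2 * X) ^ θ := Real.rpow_le_rpow hℓ0.le hlog2X hθpos
  have hkey : Real.sqrt ℓ + Real.log 2 ≤ Real.log (2 * X) ^ θ := by linarith
  -- `exp(√ℓ) + 1 ≤ 2 exp(√ℓ) = exp(√ℓ + log 2) ≤ exp((log 2X)^θ)`
  have h1 : (1 : ℝ) ≤ Real.exp (Real.sqrt ℓ) := Real.one_le_exp (Real.sqrt_nonneg _)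
  have h3 : 2 * Real.exp (Real.sqrt ℓ) = Real.exp (Real.sqrt ℓ + Real.log 2) := by
    rw [Real.exp_add, Real.exp_log (by norm_num)]; ring
  have h4 : Real.exp (Real.sqrt ℓ + Real.log 2) ≤ Real.exp (Real.log (2 * X) ^ θ) := Real.exp_le_exp.2 hkey
  linarith


/-! ### The decaying bound: the halved distance at `T = |t - t₁|/2` away from the minimiser -/

/-- (From any Vinogradov–Korobov region `HasVKZeroFreeRegion cVK TVK`, `cVK > 0`.)  **Lower bound for `M_½` of the twisted function on the decaying side.**  Assume Khale's theorem and
`2/3 < θ < 1`.  For all large `X`: if `|g| ≤ 1`, the block primes are `≤ exp(√log X)`, `t₁` is a `δ`-near-minimiser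
of `M(X, X) = min_{|u| ≤ X} 𝔻(g, n^{iu}; X)²`, `|t| ≤ X/2` and `8 ≤ |t - t₁| ≤ X/4`, then at every height
`X - 1 ≤ y ≤ 2X`,
`(log log (X-1) - θ log log 2X - 6)/4 - (δ + 4)/2 ≤ M_½(g · n^{-it}; y, |t - t₁|/2)`:
every twist `u` with `|u| ≤ |t - t₁|/2` has `|t + u| ≤ X` and `4 ≤ |t + u - t₁| ≤ 2X`, and
`TwistedPrimeSumTail.halfDistSq_ge_of_far_from_minimiser` applies at the scale `2X`
(`near_min_of_height_mem` moves the near-minimiser to the height `y`).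
[cite: MatomakiRadziwillTao2015, Appendix A, Proposition A.3 (proof)] [cite: Khale2024, Theorem 1.1] -/
theorem minHalfDistSq_twist_ge_decay_of_vk {cVK TVK : ℝ} (hcVK : 0 < cVK) (hVK : HasVKZeroFreeRegion cVK TVK) {θ : ℝ} (hθ : 2 / 3 < θ) (hθ1 : θ < 1) :
    ∀ᶠ X : ℝ in atTop, ∀ (g : ℕ → ℂ), (∀ n, ‖g n‖ ≤ 1) → ∀ (E : Finset ℕ),
      (∀ p ∈ E, (p : ℝ) ≤ Real.exp (Real.sqrt (Real.log X))) →
      ∀ (t t₁ δ y : ℝ),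
        pretentiousDistSq g (fun n : ℕ => (n : ℂ) ^ ((t₁ : ℂ) * I)) X ≤ minPretentiousDistSq g X X + δ →
        |t| ≤ X / 2 → 8 ≤ |t - t₁| → |t - t₁| ≤ X / 4 → X - 1 ≤ y → y ≤ 2 * X →
        (Real.log (Real.log (X - 1)) - θ * Real.log (Real.log (2 * X)) - 6) / 4 - (δ + 4) / 2 ≤
          minHalfDistSq E (fun n : ℕ => g n * (n : ℂ) ^ (-((t : ℂ) * I))) y (|t - t₁| / 2) := by
  have h2 : Tendsto (fun x : ℝ => 2 * x) atTop atTop := tendsto_id.const_mul_atTop (by norm_num)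
  filter_upwards [h2.eventually (TwistedPrimeSumTail.halfDistSq_ge_of_far_from_minimiser_of_vk hcVK hVK hθ),
    eventually_exp_rpow_log_le (θ := θ) (by linarith) hθ1,
    eventually_exp_sqrt_log_le (θ := θ) (by linarith),
    eventually_ge_atTop (4 : ℝ)] with X hfar hexp hsqrt hX4
  intro g hgb E hE t t₁ δ y hmin ht h8 hL hy1 hy2
  have hT' : 0 ≤ |t - t₁| / 2 := by positivity
  have hne : Nonempty (Set.Icc (-(|t - t₁| / 2)) (|t - t₁| / 2)) := ⟨⟨0, by simp [hT']⟩⟩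
  unfold minHalfDistSq
  refine le_ciInf fun u => ?_
  rw [halfDistSq_mul_twist]
  have hu : |(u : ℝ)| ≤ |t - t₁| / 2 := abs_le.2 ⟨u.2.1, u.2.2⟩
  have hE' : ∀ p ∈ E, (p : ℝ) ≤ Real.exp (Real.log (2 * X) ^ θ) - 1 := fun p hp => (hE p hp).trans hsqrt
  have hyP : Real.exp (Real.log (2 * X) ^ θ) ≤ y := hexp.trans hy1
  have hs : |t + (u : ℝ)| ≤ X := by
    have := abs_add_le t (u : ℝ); linarith
  have hmin' := near_min_of_height_mem hgb hX4 (by linarith : (0 : ℝ) ≤ X) hmin hy1 hy2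
  have habs1 : |t - t₁| ≤ |t + (u : ℝ) - t₁| + |(u : ℝ)| :=
    calc |t - t₁| = |(t + (u : ℝ) - t₁) - (u : ℝ)| := by congr 1; ring
      _ ≤ |t + (u : ℝ) - t₁| + |(u : ℝ)| := abs_sub _ _
  have habs2 : |t + (u : ℝ) - t₁| ≤ |t - t₁| + |(u : ℝ)| :=
    calc |t + (u : ℝ) - t₁| = |(t - t₁) + (u : ℝ)| := by congr 1; ring
      _ ≤ |t - t₁| + |(u : ℝ)| := abs_add_le _ _
  have h1 : 1 ≤ |t + (u : ℝ) - t₁| := by linarith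
  have h2' : |t + (u : ℝ) - t₁| ≤ 2 * X := by linarith
  have hmain := hfar g hgb E hE' y X (t + u) t₁ (δ + 4) hyP hy2 hs hmin' h1 h2'
  have hll : Real.log (Real.log (X - 1)) ≤ Real.log (Real.log y) :=
    Real.log_le_log (Real.log_pos (by linarith)) (Real.log_le_log (by linarith) hy1)
  linarith

/-- **Lower bound for `M_½` of the twisted function on the decaying side.**  Assume Khale's theorem and
`2/3 < θ < 1`.  For all large `X`: if `|g| ≤ 1`, the block primes are `≤ exp(√log X)`, `t₁` is a `δ`-near-minimiser
of `M(X, X) = min_{|u| ≤ X} 𝔻(g, n^{iu}; X)²`, `|t| ≤ X/2` and `8 ≤ |t - t₁| ≤ X/4`, then at every height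
`X - 1 ≤ y ≤ 2X`,
`(log log (X-1) - θ log log 2X - 6)/4 - (δ + 4)/2 ≤ M_½(g · n^{-it}; y, |t - t₁|/2)`:
every twist `u` with `|u| ≤ |t - t₁|/2` has `|t + u| ≤ X` and `4 ≤ |t + u - t₁| ≤ 2X`, and
`TwistedPrimeSumTail.halfDistSq_ge_of_far_from_minimiser` applies at the scale `2X`
(`near_min_of_height_mem` moves the near-minimiser to the height `y`).
[cite: MatomakiRadziwillTao2015, Appendix A, Proposition A.3 (proof)] [cite: Khale2024, Theorem 1.1] -/
theorem minHalfDistSq_twist_ge_decay (hK : Khale2024_zeroFreeRegion) {θ : ℝ} (hθ : 2 / 3 < θ) (hθ1 : θ < 1) :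
    ∀ᶠ X : ℝ in atTop, ∀ (g : ℕ → ℂ), (∀ n, ‖g n‖ ≤ 1) → ∀ (E : Finset ℕ),
      (∀ p ∈ E, (p : ℝ) ≤ Real.exp (Real.sqrt (Real.log X))) →
      ∀ (t t₁ δ y : ℝ),
        pretentiousDistSq g (fun n : ℕ => (n : ℂ) ^ ((t₁ : ℂ) * I)) X ≤ minPretentiousDistSq g X X + δ →
        |t| ≤ X / 2 → 8 ≤ |t - t₁| → |t - t₁| ≤ X / 4 → X - 1 ≤ y → y ≤ 2 * X →
        (Real.log (Real.log (X - 1)) - θ * Real.log (Real.log (2 * X)) - 6) / 4 - (δ + 4) / 2 ≤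
          minHalfDistSq E (fun n : ℕ => g n * (n : ℂ) ^ (-((t : ℂ) * I))) y (|t - t₁| / 2)  :=
  minHalfDistSq_twist_ge_decay_of_vk (by norm_num) (hasVKZeroFreeRegion_of_khale hK) hθ hθ1

/-! ### The window `|t - t₁| ≤ L`: mean square of the restricted polynomial near the minimiser -/

/-- `(1 + M) e^{-M/2} ≤ 2` for every real `M` (`e^{M/2} ≥ 1 + M/2`). [folklore] -/
theorem one_add_mul_exp_neg_half_le_two (M : ℝ) : (1 + M) * Real.exp (-M / 2) ≤ 2 := by
  have h1 : M / 2 + 1 ≤ Real.exp (M / 2) := Real.add_one_le_exp _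
  have h2 : Real.exp (M / 2) * Real.exp (-M / 2) = 1 := by
    rw [← Real.exp_add, show M / 2 + -M / 2 = 0 by ring, Real.exp_zero]
  have h3 : 0 < Real.exp (-M / 2) := Real.exp_pos _
  nlinarith

set_option maxHeartbeats 800000 in
/-- (From any Vinogradov–Korobov region `HasVKZeroFreeRegion cVK TVK`, `cVK > 0`.)  **Mean square of the block-restricted Dirichlet polynomial over the window around the minimising
twist** (the ranges `𝒯₀ ∪ 𝒯₁` of Matomäki–Radziwiłł–Tao 2015, Proposition A.3, for RESTRICTED sums and complex
`f`).  Assume Khale's theorem and `2/3 < θ < 1`.  There is an absolute `K > 0` such that for all large `X`: for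
every completely multiplicative `g` with `|g| ≤ 1`, every block system of primes `≤ min(⌈X⌉ - 1, Q)` with
`e² ≤ Q ≤ exp(√log X)`, every `δ`-near-minimiser `t₁` of `M = M(X, X) = min_{|u| ≤ X} 𝔻(g, n^{iu}; X)²`
(`δ ≥ 0`), every `16 ≤ L ≤ X/4` and every interval `[a, b] ⊆ [t₁ - L, t₁ + L] ∩ [-X/2, X/2]`,

`∫_a^b |∑_{⌈X⌉ ≤ n ≤ ⌊2X⌋, n ∈ 𝒮} g(n) n^{-(1+it)}|² dt ≤ K ((1 + M) e^{-M/2} + 1/L + (|𝓙|+1) ρ + L ((|𝓙|+1)² ρ² + u²))`,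

`ρ = √((log Q + 2)/log X)`, `u = (1 + M₁⁺) e^{-M₁⁺}`, `M₁ = (log log(X-1) - θ log log 2X - 6)/4 - (δ+4)/2`
(so `u² = (log X)^{-(1-θ)/2 + o(1)}`).  Proof: the uniform bound
`|F(1+it)| ≤ K₀ ((1 + M'/2) e^{-M'/2} + 2/X + (|𝓙|+1) ρ)` (`norm_restr_dirichlet_le` with `T = X/2`,
`minHalfDistSq_twist_ge_half_min`, `M' = M(X-1, X) ≥ M - 4/3`), the decaying bound
`|F(1+it)| ≤ 2K₀/|t - t₁| + K₀ (u + (|𝓙|+1) ρ)` for `|t - t₁| ≥ 8` (`norm_restr_dirichlet_le` with `T = |t - t₁|/2`,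
`minHalfDistSq_twist_ge_decay`), and `MeanSquareNearPeak.integral_sq_le_peak_decay_on`.  With `L = (log X)^{1/16}`,
`Q = Q_J ≤ exp(√log X₀)`, `|𝓙| = J ≪ log log X` this is the contribution `≪ (1 + M) e^{-M/2} + (log X)^{-1/16}` of
`𝒯₀ ∪ 𝒯₁` to the restricted-Halász form `MRT2015.PropA3With (fun M => C (1 + M) e^{-M/2})` of Proposition A.3.
[cite: MatomakiRadziwillTao2015, Appendix A, Proposition A.3 (proof)] [cite: Khale2024, Theorem 1.1] -/
theorem integral_sq_restr_dirichlet_window_le_of_vk {cVK TVK : ℝ} (hcVK : 0 < cVK) (hVK : HasVKZeroFreeRegion cVK TVK) {θ : ℝ} (hθ : 2 / 3 < θ)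
    (hθ1 : θ < 1) :
    ∃ K : ℝ, 0 < K ∧ ∀ᶠ X : ℝ in atTop, ∀ (𝓙 : Finset ℕ) (blk : ℕ → Finset ℕ) (g : ℕ → ℂ),
      (∀ m n, g (m * n) = g m * g n) → g 1 = 1 → (∀ n, ‖g n‖ ≤ 1) →
      ∀ (Q t₁ δ L a b : ℝ), Real.exp 2 ≤ Q → Q ≤ Real.exp (Real.sqrt (Real.log X)) →
        IsBlockSystem 𝓙 blk (⌈X⌉₊ - 1) → (∀ i ∈ 𝓙, ∀ p ∈ blk i, (p : ℝ) ≤ Q) → 0 ≤ δ →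
        pretentiousDistSq g (fun n : ℕ => (n : ℂ) ^ ((t₁ : ℂ) * I)) X ≤ minPretentiousDistSq g X X + δ →
        16 ≤ L → L ≤ X / 4 → a ≤ b → t₁ - L ≤ a → b ≤ t₁ + L → -(X / 2) ≤ a → b ≤ X / 2 →
        ∫ t in a..b, ‖∑ n ∈ (Finset.Icc ⌈X⌉₊ ⌊2 * X⌋₊).filter (MemBlocks 𝓙 blk),
            g n * (n : ℂ) ^ (-(1 + (t : ℂ) * I))‖ ^ 2 ≤
          K * ((1 + minPretentiousDistSq g X X) * Real.exp (-minPretentiousDistSq g X X / 2) + 1 / L +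
            (𝓙.card + 1) * Real.sqrt ((Real.log Q + 2) / Real.log X) +
            L * (((𝓙.card + 1) * Real.sqrt ((Real.log Q + 2) / Real.log X)) ^ 2 +
              ((1 + max 0 ((Real.log (Real.log (X - 1)) - θ * Real.log (Real.log (2 * X)) - 6) / 4 - (δ + 4) / 2)) *
                Real.exp (-max 0 ((Real.log (Real.log (X - 1)) - θ * Real.log (Real.log (2 * X)) - 6) / 4 -
                  (δ + 4) / 2))) ^ 2)) := by
  obtain ⟨K, hK0, hH⟩ := norm_restr_dirichlet_le
  refine ⟨800 * K ^ 2, by positivity, ?_⟩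
  filter_upwards [minHalfDistSq_twist_ge_decay_of_vk hcVK hVK hθ hθ1, eventually_ge_atTop (64 : ℝ)] with X hdec hX64
  intro 𝓙 blk g hg hg1 hgb Q t₁ δ L a b hQ hQX hsys hblkQ hδ hmin hL16 hLX hab ha hb haX hbX
  -- notation
  set M : ℝ := minPretentiousDistSq g X X with hMdef
  set M' : ℝ := minPretentiousDistSq g (X - 1) X with hM'def
  set M₁ : ℝ := (Real.log (Real.log (X - 1)) - θ * Real.log (Real.log (2 * X)) - 6) / 4 - (δ + 4) / 2 with hM₁def
  set Mp : ℝ := max 0 M₁ with hMpdef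
  set u : ℝ := (1 + Mp) * Real.exp (-Mp) with hudef
  set ρ' : ℝ := (𝓙.card + 1) * Real.sqrt ((Real.log Q + 2) / Real.log X) with hρ'def
  set P : ℝ := (1 + M) * Real.exp (-M / 2) with hPdef
  set φ : ℝ → ℝ := fun t => ‖∑ n ∈ (Finset.Icc ⌈X⌉₊ ⌊2 * X⌋₊).filter (MemBlocks 𝓙 blk),
    g n * (n : ℂ) ^ (-(1 + (t : ℂ) * I))‖ with hφdef
  have hX4 : 4 ≤ X := by linarith
  have hX0 : 0 < X := by linarith
  have hM0 : 0 ≤ M := minPretentiousDistSq_nonneg hgb X hX0.le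
  have hM'0 : 0 ≤ M' := minPretentiousDistSq_nonneg hgb (X - 1) hX0.le
  have hMp0 : 0 ≤ Mp := le_max_left _ _
  have hρ'0 : 0 ≤ ρ' := by positivity
  have hP0 : 0 ≤ P := by positivity
  have hP2 : P ≤ 2 := one_add_mul_exp_neg_half_le_two M
  have hu0 : 0 ≤ u := by positivity
  have hu1 : u ≤ 1 := by
    have := Tao2016.one_add_mul_exp_neg_le le_rfl hMp0
    simpa using this
  have hL1 : 1 ≤ L := by linarith
  have hL0 : 0 < L := by linarith
  -- `M' ≥ M - 4/3`
  have hM'M : M - 4 / 3 ≤ M' := by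
    have h1 := minPretentiousDistSq_le_add_tail hgb hX0.le (by linarith : X - 1 ≤ X) (g := g)
    have h2 : ∑ p ∈ (Finset.Ioc ⌊X - 1⌋₊ ⌊X⌋₊).filter Nat.Prime, (1 : ℝ) / p ≤ 2 / 3 := by
      refine (sum_inv_prime_Ioc_le (by linarith) (by linarith)).trans ?_
      rw [div_le_div_iff₀ (by linarith) (by norm_num)]; nlinarith
    simp only [hMdef, hM'def]; linarith
  -- continuity (`Sieve.MatomakiRadziwillLemma12.continuous_dsum`) and nonnegativity of `φ`
  have hφc : Continuous φ := (Sieve.MatomakiRadziwillLemma12.continuous_dsum _ g).norm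
  have hφ0 : ∀ t, 0 ≤ φ t := fun t => norm_nonneg _
  -- (a) the uniform bound on `[a, b]`
  set B : ℝ := K * ((1 + M' / 2) * Real.exp (-(M' / 2)) + 1 / (X / 2) + ρ') with hBdef
  have hpeak : ∀ t ∈ Set.Icc a b, φ t ≤ B := by
    intro t ht
    have htX : |t| ≤ X / 2 := abs_le.2 ⟨by linarith [ht.1], by linarith [ht.2]⟩
    have hwin : ∀ y : ℝ, X - 1 ≤ y → y ≤ 2 * X →
        M' / 2 ≤ minHalfDistSq (𝓙.biUnion blk) (fun n : ℕ => g n * (n : ℂ) ^ (-((t : ℂ) * I))) y (X / 2) := by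
      intro y hy1 _
      have h1 := minHalfDistSq_twist_ge_half_min hgb (𝓙.biUnion blk) hX0.le htX y
      have h2 := minPretentiousDistSq_mono_height hgb hX0.le hy1 (g := g)
      simp only [hM'def]; linarith
    have := hH 𝓙 blk g hg hg1 hgb t X (X / 2) Q (M' / 2) hX4 (by linarith) hQ hsys hblkQ (by linarith) hwin
    simpa only [hφdef, hBdef] using this
  -- (b) the decaying bound on `[a, b]`
  set D : ℝ := 2 * K with hDdef
  set E₀ : ℝ := K * (u + ρ') with hE₀def
  have hdecay : ∀ t ∈ Set.Icc a b, 8 ≤ |t - t₁| → φ t ≤ D / |t - t₁| + E₀ := by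
    intro t ht h8
    have htX : |t| ≤ X / 2 := abs_le.2 ⟨by linarith [ht.1], by linarith [ht.2]⟩
    have htL : |t - t₁| ≤ L := abs_le.2 ⟨by linarith [ht.1], by linarith [ht.2]⟩
    have hE : ∀ p ∈ 𝓙.biUnion blk, (p : ℝ) ≤ Real.exp (Real.sqrt (Real.log X)) := by
      intro p hp
      rw [Finset.mem_biUnion] at hp
      obtain ⟨i, hi, hpi⟩ := hp
      exact (hblkQ i hi p hpi).trans hQX
    have hwin : ∀ y : ℝ, X - 1 ≤ y → y ≤ 2 * X →
        Mp ≤ minHalfDistSq (𝓙.biUnion blk) (fun n : ℕ => g n * (n : ℂ) ^ (-((t : ℂ) * I))) y (|t - t₁| / 2) := by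
      intro y hy1 hy2
      refine max_le (minHalfDistSq_nonneg (norm_mul_twist_le hgb t) _ y (by positivity)) ?_
      exact hdec g hgb _ hE t t₁ δ y hmin htX h8 (by linarith) hy1 hy2
    have := hH 𝓙 blk g hg hg1 hgb t X (|t - t₁| / 2) Q Mp hX4 (by linarith) hQ hsys hblkQ hMp0 hwin
    have habs0 : 0 < |t - t₁| := by linarith
    have hrw : K * ((1 + Mp) * Real.exp (-Mp) + 1 / (|t - t₁| / 2) + ρ') = D / |t - t₁| + E₀ := by
      simp only [hDdef, hE₀def, hudef]; field_simp; ring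
    rw [← hrw]
    simpa only [hφdef] using this
  -- the window lemma
  have hB0 : 0 < B := by
    have h1 : 0 < 1 / (X / 2) := by positivity
    have h2 : 0 ≤ (1 + M' / 2) * Real.exp (-(M' / 2)) := by positivity
    simp only [hBdef]; positivity
  have hD0 : 0 ≤ D := by positivity
  have hE₀0 : 0 ≤ E₀ := by positivity
  have hA := MeanSquareNearPeak.integral_sq_le_peak_decay_on hφc hφ0 hB0 hD0 hE₀0 (by norm_num : (0:ℝ) < 8)
    (by linarith : 2 * 8 ≤ L) hab ha hb hpeak hdecay
  refine hA.trans ?_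
  -- bookkeeping
  have hexpM' : (1 + M' / 2) * Real.exp (-(M' / 2)) ≤ 2 * P := by
    have h1 := Sieve.HalaszMT.one_add_mul_exp_neg_le_of_sub_le (M := M / 2) (M' := M' / 2) (c := 2 / 3)
      (by positivity) (by positivity) (by norm_num) (by linarith)
    have h2 : Real.exp (2 / 3 : ℝ) ≤ 2 := by
      have h := Real.log_two_gt_d9
      have : Real.exp (2 / 3 : ℝ) ≤ Real.exp (Real.log 2) := Real.exp_le_exp.2 (by linarith)
      rwa [Real.exp_log (by norm_num)] at this
    have h3 : (1 + M / 2) * Real.exp (-(M / 2)) ≤ P := by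
      simp only [hPdef]
      rw [show -M / 2 = -(M / 2) by ring]
      exact mul_le_mul_of_nonneg_right (by linarith) (Real.exp_pos _).le
    have h4 : 0 ≤ (1 + M / 2) * Real.exp (-(M / 2)) := by positivity
    calc (1 + M' / 2) * Real.exp (-(M' / 2)) ≤ Real.exp (2 / 3 : ℝ) * ((1 + M / 2) * Real.exp (-(M / 2))) := h1
      _ ≤ 2 * ((1 + M / 2) * Real.exp (-(M / 2))) := mul_le_mul_of_nonneg_right h2 h4
      _ ≤ 2 * P := by linarith
  have hBle : B ≤ K * (2 * P + 1 / L + ρ') := by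
    have h1 : 1 / (X / 2) ≤ 1 / L := by
      rw [div_le_div_iff₀ (by positivity) hL0]; linarith
    simp only [hBdef]
    gcongr
  have hB2 : B ^ 2 ≤ K ^ 2 * (24 * P + 3 * (1 / L) + 3 * (L * ρ' ^ 2)) := by
    have h1 : B ^ 2 ≤ (K * (2 * P + 1 / L + ρ')) ^ 2 := pow_le_pow_left₀ hB0.le hBle 2
    have h2 : (2 * P + 1 / L + ρ') ^ 2 ≤ 3 * ((2 * P) ^ 2 + (1 / L) ^ 2 + ρ' ^ 2) := by
      linarith [sq_nonneg (2 * P - 1 / L), sq_nonneg (2 * P - ρ'), sq_nonneg (1 / L - ρ')]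
    have h3 : P ^ 2 ≤ 2 * P := by rw [sq]; exact mul_le_mul_of_nonneg_right hP2 hP0
    have h4 : (1 / L) ^ 2 ≤ 1 / L := by
      have h41 : 1 / L ≤ 1 := by rw [div_le_one hL0]; exact hL1
      have h42 : 0 ≤ 1 / L := by positivity
      calc (1 / L) ^ 2 = (1 / L) * (1 / L) := sq _
        _ ≤ 1 * (1 / L) := mul_le_mul_of_nonneg_right h41 h42
        _ = 1 / L := one_mul _
    have h5 : ρ' ^ 2 ≤ L * ρ' ^ 2 := le_mul_of_one_le_left (sq_nonneg _) hL1
    have hK2 : 0 ≤ K ^ 2 := sq_nonneg _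
    calc B ^ 2 ≤ (K * (2 * P + 1 / L + ρ')) ^ 2 := h1
      _ = K ^ 2 * (2 * P + 1 / L + ρ') ^ 2 := by ring
      _ ≤ K ^ 2 * (3 * ((2 * P) ^ 2 + (1 / L) ^ 2 + ρ' ^ 2)) := mul_le_mul_of_nonneg_left h2 hK2
      _ ≤ K ^ 2 * (24 * P + 3 * (1 / L) + 3 * (L * ρ' ^ 2)) := by
          refine mul_le_mul_of_nonneg_left ?_ hK2
          linarith
  have hKB : K * B ≤ K ^ 2 * (2 * P + 1 / L + ρ') := by
    have := mul_le_mul_of_nonneg_left hBle hK0.le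
    linarith [this]
  have hE2 : L * E₀ ^ 2 ≤ 2 * K ^ 2 * (L * u ^ 2 + L * ρ' ^ 2) := by
    have h1 : E₀ ^ 2 ≤ 2 * K ^ 2 * (u ^ 2 + ρ' ^ 2) := by
      simp only [hE₀def]
      calc (K * (u + ρ')) ^ 2 = K ^ 2 * (u + ρ') ^ 2 := by ring
        _ ≤ K ^ 2 * (2 * (u ^ 2 + ρ' ^ 2)) :=
            mul_le_mul_of_nonneg_left (by linarith [sq_nonneg (u - ρ')]) (sq_nonneg K)
        _ = 2 * K ^ 2 * (u ^ 2 + ρ' ^ 2) := by ring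
    have := mul_le_mul_of_nonneg_left h1 hL0.le
    linarith [this]
  have hDL : 4 * D ^ 2 / L = 16 * K ^ 2 * (1 / L) := by
    simp only [hDdef]; field_simp; ring
  rw [hDL]
  simp only [hDdef]
  have hiL0 : 0 ≤ 1 / L := by positivity
  have hK2 : 0 ≤ K ^ 2 := sq_nonneg _
  linarith [hB2, hKB, hE2, mul_nonneg hK2 hP0, mul_nonneg hK2 hρ'0, mul_nonneg hK2 hiL0,
    mul_nonneg hK2 (mul_nonneg hL0.le (sq_nonneg u)), mul_nonneg hK2 (mul_nonneg hL0.le (sq_nonneg ρ'))]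

/-- **Mean square of the block-restricted Dirichlet polynomial over the window around the minimising
twist** (the ranges `𝒯₀ ∪ 𝒯₁` of Matomäki–Radziwiłł–Tao 2015, Proposition A.3, for RESTRICTED sums and complex
`f`).  Assume Khale's theorem and `2/3 < θ < 1`.  There is an absolute `K > 0` such that for all large `X`: for
every completely multiplicative `g` with `|g| ≤ 1`, every block system of primes `≤ min(⌈X⌉ - 1, Q)` with
`e² ≤ Q ≤ exp(√log X)`, every `δ`-near-minimiser `t₁` of `M = M(X, X) = min_{|u| ≤ X} 𝔻(g, n^{iu}; X)²`
(`δ ≥ 0`), every `16 ≤ L ≤ X/4` and every interval `[a, b] ⊆ [t₁ - L, t₁ + L] ∩ [-X/2, X/2]`,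

`∫_a^b |∑_{⌈X⌉ ≤ n ≤ ⌊2X⌋, n ∈ 𝒮} g(n) n^{-(1+it)}|² dt ≤ K ((1 + M) e^{-M/2} + 1/L + (|𝓙|+1) ρ + L ((|𝓙|+1)² ρ² + u²))`,

`ρ = √((log Q + 2)/log X)`, `u = (1 + M₁⁺) e^{-M₁⁺}`, `M₁ = (log log(X-1) - θ log log 2X - 6)/4 - (δ+4)/2`
(so `u² = (log X)^{-(1-θ)/2 + o(1)}`).  Proof: the uniform bound
`|F(1+it)| ≤ K₀ ((1 + M'/2) e^{-M'/2} + 2/X + (|𝓙|+1) ρ)` (`norm_restr_dirichlet_le` with `T = X/2`,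
`minHalfDistSq_twist_ge_half_min`, `M' = M(X-1, X) ≥ M - 4/3`), the decaying bound
`|F(1+it)| ≤ 2K₀/|t - t₁| + K₀ (u + (|𝓙|+1) ρ)` for `|t - t₁| ≥ 8` (`norm_restr_dirichlet_le` with `T = |t - t₁|/2`,
`minHalfDistSq_twist_ge_decay`), and `MeanSquareNearPeak.integral_sq_le_peak_decay_on`.  With `L = (log X)^{1/16}`,
`Q = Q_J ≤ exp(√log X₀)`, `|𝓙| = J ≪ log log X` this is the contribution `≪ (1 + M) e^{-M/2} + (log X)^{-1/16}` of
`𝒯₀ ∪ 𝒯₁` to the restricted-Halász form `MRT2015.PropA3With (fun M => C (1 + M) e^{-M/2})` of Proposition A.3.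
[cite: MatomakiRadziwillTao2015, Appendix A, Proposition A.3 (proof)] [cite: Khale2024, Theorem 1.1] -/
theorem integral_sq_restr_dirichlet_window_le (hK : Khale2024_zeroFreeRegion) {θ : ℝ} (hθ : 2 / 3 < θ)
    (hθ1 : θ < 1) :
    ∃ K : ℝ, 0 < K ∧ ∀ᶠ X : ℝ in atTop, ∀ (𝓙 : Finset ℕ) (blk : ℕ → Finset ℕ) (g : ℕ → ℂ),
      (∀ m n, g (m * n) = g m * g n) → g 1 = 1 → (∀ n, ‖g n‖ ≤ 1) →
      ∀ (Q t₁ δ L a b : ℝ), Real.exp 2 ≤ Q → Q ≤ Real.exp (Real.sqrt (Real.log X)) →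
        IsBlockSystem 𝓙 blk (⌈X⌉₊ - 1) → (∀ i ∈ 𝓙, ∀ p ∈ blk i, (p : ℝ) ≤ Q) → 0 ≤ δ →
        pretentiousDistSq g (fun n : ℕ => (n : ℂ) ^ ((t₁ : ℂ) * I)) X ≤ minPretentiousDistSq g X X + δ →
        16 ≤ L → L ≤ X / 4 → a ≤ b → t₁ - L ≤ a → b ≤ t₁ + L → -(X / 2) ≤ a → b ≤ X / 2 →
        ∫ t in a..b, ‖∑ n ∈ (Finset.Icc ⌈X⌉₊ ⌊2 * X⌋₊).filter (MemBlocks 𝓙 blk),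
            g n * (n : ℂ) ^ (-(1 + (t : ℂ) * I))‖ ^ 2 ≤
          K * ((1 + minPretentiousDistSq g X X) * Real.exp (-minPretentiousDistSq g X X / 2) + 1 / L +
            (𝓙.card + 1) * Real.sqrt ((Real.log Q + 2) / Real.log X) +
            L * (((𝓙.card + 1) * Real.sqrt ((Real.log Q + 2) / Real.log X)) ^ 2 +
              ((1 + max 0 ((Real.log (Real.log (X - 1)) - θ * Real.log (Real.log (2 * X)) - 6) / 4 - (δ + 4) / 2)) *
                Real.exp (-max 0 ((Real.log (Real.log (X - 1)) - θ * Real.log (Real.log (2 * X)) - 6) / 4 -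
                  (δ + 4) / 2))) ^ 2))  :=
  integral_sq_restr_dirichlet_window_le_of_vk (by norm_num) (hasVKZeroFreeRegion_of_khale hK) hθ hθ1

end Restricted

end Halasz

end Literature.NumberTheory.LFunctions

end
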